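import Summits.AtomisticToContinuum.Crystallization.Theorems.StackingFaultSparsity.Negative.HcpTwin
import Summits.AtomisticToContinuum.Crystallization.Theorems.ThreeConeCertificateSlackRigidityLayeringIdeal

/-!
# `StackingFaultSparsity` (stmt-AtomisticToContinuum-14296), negative side II: one-sided dimers are Barlow windows

Part II of the refuter's negative-side lemmas (I: `HcpTwin`, III: `DimerGas`).

* `four_le_of_parity`, `dist_barlowPos_origin_sq` — lateral offsets between points of a Barlow
  stacking are `0` or `≥ a/√3` (integer coordinates `X = 2i + j + L`, `Y = 3j + L` of equal parity).
* `window_cases` — WINDOW CENSUS at `(a, h, R) = (199/100, 11/20, 6/5)` for ANY Hägg sequence: a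
  stacking point within `6/5` of a site is the site itself or sits straight above/below it two layers
  away, which requires those layers to be aligned (`3 ∣ L`).
* (the origin lemma `barlowPos_zero_zero_zero` is reused from `CLayerWitnessLayeringIdeal`;)
* `sUp` / `sDown` — Hägg sequences with exactly one of the layers `±2` aligned with layer `0`
  (letters `B C A B A`, resp. `A B A B C`); `barlowPos_sUp_two`, `barlowPos_sDown_neg_two`.
* `barlowMatched_of_dimer_up` / `_down` — a particle whose only companion within `10` sits at
  `± (0, 0, 11/10)` IS `(6/5, 1/100)`-matched (exactly) to the stacking of `sUp` / `sDown`;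
  `barlowMatched_of_isolated` — an isolated particle is matched (window = the site alone, `a = h = 199/100`).
-/

noncomputable section

namespace Summit.AtomisticToContinuum.Crystallization.Theorems.StackingFaultSparsityNegative

open Literature.MathematicalPhysics.StatisticalMechanics
open Summit.AtomisticToContinuum.Crystallization.Theorems.CLayerWitnessLayeringIdeal (barlowPos_zero_zero_zero)

/-! ## §2. Windows of radius `6/5` in Barlow stackings with `a = 199/100`, `h = 11/20` -/

/-- Parity lemma: integers `X ≡ Y (mod 2)`, not both zero, have `3X² + Y² ≥ 4`. [folklore] -/
theorem four_le_of_parity {X Y : ℤ} (hpar : Even (X - Y)) (hne : (X, Y) ≠ 0) :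
    4 ≤ 3 * X ^ 2 + Y ^ 2 := by
  rcases Int.even_or_odd Y with ⟨t, rfl⟩ | ⟨t, rfl⟩
  · have hX : Even X := by
      have : X = (X - (t + t)) + (t + t) := by ring
      rw [this]; exact hpar.add ⟨t, rfl⟩
    obtain ⟨u, rfl⟩ := hX
    by_cases ht : t = 0
    · subst ht
      have hu : u ≠ 0 := by rintro rfl; exact hne (by simp)
      have : 0 < u ^ 2 := by positivity
      nlinarith
    · have : 0 < t ^ 2 := by positivity
      nlinarith
  · have hX : Odd X := by
      have : X = (X - (2 * t + 1)) + (2 * t + 1) := by ring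
      rw [this]; exact hpar.add_odd ⟨t, rfl⟩
    obtain ⟨u, rfl⟩ := hX
    have hu : 0 ≤ u * (u + 1) := by
      rcases le_or_gt 0 u with h0 | h0
      · positivity
      · have h1 : u + 1 ≤ 0 := by omega
        exact mul_nonneg_of_nonpos_of_nonpos h0.le h1
    have ht : 0 ≤ t * (t + 1) := by
      rcases le_or_gt 0 t with h0 | h0
      · positivity
      · have h1 : t + 1 ≤ 0 := by omega
        exact mul_nonneg_of_nonpos_of_nonpos h0.le h1
    have key : 3 * (2 * u + 1) ^ 2 + (2 * t + 1) ^ 2 =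
        12 * (u * (u + 1)) + 4 * (t * (t + 1)) + 4 := by ring
    rw [key]
    linarith

/-- Squared distance to the origin site of layer `0` in the integer coordinates `X = 2i + j + L`,
`Y = 3j + L` (`L` the label of layer `k`): `a² (3X² + Y²)/12 + (k h)²`. [folklore] -/
theorem dist_barlowPos_origin_sq (a h : ℝ) (s : ℤ → ℤ) (k i j : ℤ) :
    dist (barlowPos a h s k i j) (barlowPos a h s 0 0 0) ^ 2 =
      a ^ 2 * (3 * (2 * i + j + haggLabel s k) ^ 2 + (3 * j + haggLabel s k) ^ 2 : ℤ) / 12 +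
        (k * h) ^ 2 := by
  rw [dist_barlowPos_sq]
  have h3 : (√3 : ℝ) ^ 2 = 3 := Real.sq_sqrt (by norm_num)
  simp only [haggLabel_zero, Int.cast_zero, sub_zero]
  push_cast
  linear_combination (a ^ 2 * (3 * j + haggLabel s k) ^ 2 / 36) * h3

/-- **Window census at `(a, h, R) = (199/100, 11/20, 6/5)`, any Hägg sequence.** A stacking point
within `6/5` of a site is the site itself or lies straight above/below it TWO layers away
(`i = j = -L/3`, which requires those layers to be aligned, `3 ∣ L`): in-layer points are `≥ a`
away, adjacent-layer points `≥ √(a²/3 + h²) > 6/5`, non-aligned second layers `≥ √(a²/3 + 4h²)`,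
third layers `≥ 3h > 6/5` (lateral offsets in a Barlow stacking are `0` or `≥ a/√3`, by
`four_le_of_parity`). [new] -/
theorem window_cases {s : ℤ → ℤ} (hs : IsHaggSeq s) {k i j : ℤ}
    (hd : dist (barlowPos (199 / 100) (11 / 20) s k i j) (barlowPos (199 / 100) (11 / 20) s 0 0 0)
      ≤ 6 / 5) :
    (k = 0 ∧ i = 0 ∧ j = 0) ∨ ((k = 2 ∨ k = -2) ∧ haggLabel s k = -3 * j ∧ i = j) := by
  have hsq := dist_barlowPos_origin_sq (199 / 100) (11 / 20) s k i j
  set L := haggLabel s k with hLdef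
  set Q : ℤ := 3 * (2 * i + j + L) ^ 2 + (3 * j + L) ^ 2 with hQ
  have hd2 : dist (barlowPos (199 / 100) (11 / 20) s k i j) (barlowPos (199 / 100) (11 / 20) s 0 0 0)
      ^ 2 ≤ (6 / 5) ^ 2 := by gcongr
  rw [hsq] at hd2
  have hQnn : (0 : ℤ) ≤ Q := by positivity
  have hQnn' : (0 : ℝ) ≤ (Q : ℝ) := by exact_mod_cast hQnn
  have hk2 : k ^ 2 ≤ 4 := by
    by_contra hk
    have hk5 : (5 : ℤ) ≤ k ^ 2 := by
      push Not at hk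
      have : 4 < k ^ 2 := hk
      omega
    have : (5 : ℝ) ≤ (k : ℝ) ^ 2 := by exact_mod_cast hk5
    nlinarith
  have hQ0 : Q = 0 := by
    by_contra hQne
    have hXY : ((2 * i + j + L, 3 * j + L) : ℤ × ℤ) ≠ 0 := by
      intro h0
      rw [Prod.mk_eq_zero] at h0
      apply hQne
      rw [hQ, h0.1, h0.2]; norm_num
    have h4 : 4 ≤ Q := four_le_of_parity ⟨i - j, by ring⟩ hXY
    have h4' : (4 : ℝ) ≤ (Q : ℝ) := by exact_mod_cast h4
    have hk0 : k = 0 := by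
      by_contra hk0
      have : (1 : ℤ) ≤ k ^ 2 := by
        have : 0 < k ^ 2 := by positivity
        omega
      have : (1 : ℝ) ≤ (k : ℝ) ^ 2 := by exact_mod_cast this
      nlinarith
    have hL0 : L = 0 := by rw [hLdef, hk0, haggLabel_zero]
    have hij : ((i, j) : ℤ × ℤ) ≠ 0 := by
      intro h0
      rw [Prod.mk_eq_zero] at h0
      apply hXY
      rw [h0.1, h0.2, hL0]; norm_num
    have h12 : 12 ≤ Q := by
      have := one_le_sq_add_mul_add_sq hij
      rw [hQ, hL0]; nlinarith
    have h12' : (12 : ℝ) ≤ (Q : ℝ) := by exact_mod_cast h12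
    nlinarith
  have hY : 3 * j + L = 0 := by
    by_contra hY
    have : 0 < (3 * j + L) ^ 2 := by positivity
    have : 0 ≤ 3 * (2 * i + j + L) ^ 2 := by positivity
    omega
  have hX : 2 * i + j + L = 0 := by
    by_contra hX
    have : 0 < (2 * i + j + L) ^ 2 := by positivity
    have : 0 ≤ (3 * j + L) ^ 2 := by positivity
    omega
  have hLj : L = -3 * j := by omega
  have hij : i = j := by omega
  have hk : k = 0 ∨ k = 1 ∨ k = -1 ∨ k = 2 ∨ k = -2 := by
    have : -2 ≤ k ∧ k ≤ 2 := by
      constructor <;> nlinarith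
    omega
  rcases hk with rfl | rfl | rfl | rfl | rfl
  · left
    have : L = 0 := by rw [hLdef, haggLabel_zero]
    exact ⟨rfl, by omega, by omega⟩
  · exfalso
    have h1 : haggLabel s 1 = s 0 := by
      have := haggLabel_succ s 0
      simpa using this
    rcases hs 0 with h0 | h0 <;> omega
  · exfalso
    have h1 : haggLabel s (-1) = -s (-1) := by
      have := haggLabel_succ s (-1)
      simp at this
      linarith
    rcases hs (-1) with h0 | h0 <;> omega
  · right; exact ⟨Or.inl rfl, hLj, hij⟩
  · right; exact ⟨Or.inr rfl, hLj, hij⟩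

/-- Hägg sequence `…, +, +, +, (− at 1), +, …`: around layer `0` the letters are `B C A B A` —
layers `0` and `2` aligned, `0` and `−2` not. [new] -/
def sUp : ℤ → ℤ := fun m => if m = 1 then -1 else 1

/-- Hägg sequence with `−` at `−1` only: letters `A B A B C` around layer `0` — layers `0` and `−2`
aligned, `0` and `2` not. [new] -/
def sDown : ℤ → ℤ := fun m => if m = -1 then -1 else 1

/-- `sUp` is a Hägg sequence. [folklore] -/
theorem isHaggSeq_sUp : IsHaggSeq sUp := fun m => by unfold sUp; split_ifs <;> simp

/-- `sDown` is a Hägg sequence. [folklore] -/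
theorem isHaggSeq_sDown : IsHaggSeq sDown := fun m => by unfold sDown; split_ifs <;> simp

/-- Layer `2` of `sUp` is aligned with layer `0`. [folklore] -/
theorem haggLabel_sUp_two : haggLabel sUp 2 = 0 := by
  rw [show (2 : ℤ) = ((2 : ℕ) : ℤ) by rfl, haggLabel_natCast]
  simp [haggWindow, Finset.sum_range_succ, sUp]

/-- Layer `−2` of `sUp` is not aligned with layer `0`. [folklore] -/
theorem haggLabel_sUp_neg_two : haggLabel sUp (-2) = -2 := by
  rw [show (-2 : ℤ) = -((2 : ℕ) : ℤ) by rfl, haggLabel_neg_natCast]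
  simp [haggWindow, Finset.sum_range_succ, sUp]

/-- Layer `2` of `sDown` is not aligned with layer `0`. [folklore] -/
theorem haggLabel_sDown_two : haggLabel sDown 2 = 2 := by
  rw [show (2 : ℤ) = ((2 : ℕ) : ℤ) by rfl, haggLabel_natCast]
  simp [haggWindow, sDown]

/-- Layer `−2` of `sDown` is aligned with layer `0`. [folklore] -/
theorem haggLabel_sDown_neg_two : haggLabel sDown (-2) = 0 := by
  rw [show (-2 : ℤ) = -((2 : ℕ) : ℤ) by rfl, haggLabel_neg_natCast]
  simp [haggWindow, Finset.sum_range_succ, sDown]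

/-- The aligned site two layers above the origin of `sUp` is `(0, 0, 11/10)`. [folklore] -/
theorem barlowPos_sUp_two :
    barlowPos (199 / 100) (11 / 20) sUp 2 0 0 = !₂[0, 0, 11 / 10] := by
  ext l
  fin_cases l
  · simp [haggLabel_sUp_two]
  · simp [haggLabel_sUp_two]
  · simp; norm_num

/-- The aligned site two layers below the origin of `sDown` is `(0, 0, −11/10)`. [folklore] -/
theorem barlowPos_sDown_neg_two :
    barlowPos (199 / 100) (11 / 20) sDown (-2) 0 0 = !₂[0, 0, -(11 / 10)] := by
  ext l
  fin_cases l
  · simp [haggLabel_sDown_neg_two]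
  · simp [haggLabel_sDown_neg_two]
  · simp; norm_num

/-- **An upward dimer is a Barlow window.** If `X j₀ = X i + (0, 0, 11/10)` and the only particles
within `10` of `X i` sit at `X i` or `X j₀`, then `i` is `(6/5, 1/100)`-matched (indeed exactly) to
the stacking of `sUp` with `a = 199/100`, `h = 11/20`, centred at its origin, `A = id`. [new] -/
theorem barlowMatched_of_dimer_up {N : ℕ} (X : Fin N → E3) (i j₀ : Fin N)
    (hq : X j₀ = X i + !₂[0, 0, 11 / 10])
    (hiso : ∀ j : Fin N, dist (X j) (X i) < 10 → X j = X i ∨ X j = X j₀) :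
    BarlowMatched (6 / 5) (1 / 100) X i := by
  refine ⟨199 / 100, 11 / 20, by norm_num, by norm_num, by norm_num, by norm_num, sUp, isHaggSeq_sUp,
    barlowPos (199 / 100) (11 / 20) sUp 0 0 0, barlowPos_mem _ _ _, LinearIsometry.id, ?_, ?_⟩
  · rintro p ⟨k, i', j', rfl⟩ hpd
    rcases window_cases isHaggSeq_sUp hpd with ⟨rfl, rfl, rfl⟩ | ⟨hk, hL, hij⟩
    · exact ⟨i, by simp⟩
    · rcases hk with rfl | rfl
      · rw [haggLabel_sUp_two] at hL
        obtain rfl : j' = 0 := by omega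
        obtain rfl : i' = 0 := by omega
        refine ⟨j₀, ?_⟩
        rw [hq, barlowPos_zero_zero_zero, sub_zero, barlowPos_sUp_two]
        simp
      · rw [haggLabel_sUp_neg_two] at hL
        omega
  · intro j hj
    rcases hiso j (by linarith) with hji | hjj
    · exact ⟨_, barlowPos_mem 0 0 0, by rw [hji]; simp⟩
    · refine ⟨_, barlowPos_mem 2 0 0, ?_⟩
      rw [hjj, hq, barlowPos_zero_zero_zero, sub_zero, barlowPos_sUp_two]
      simp

/-- **A downward dimer is a Barlow window** (stacking of `sDown`). [new] -/
theorem barlowMatched_of_dimer_down {N : ℕ} (X : Fin N → E3) (i j₀ : Fin N)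
    (hq : X j₀ = X i + !₂[0, 0, -(11 / 10)])
    (hiso : ∀ j : Fin N, dist (X j) (X i) < 10 → X j = X i ∨ X j = X j₀) :
    BarlowMatched (6 / 5) (1 / 100) X i := by
  refine ⟨199 / 100, 11 / 20, by norm_num, by norm_num, by norm_num, by norm_num, sDown,
    isHaggSeq_sDown, barlowPos (199 / 100) (11 / 20) sDown 0 0 0, barlowPos_mem _ _ _,
    LinearIsometry.id, ?_, ?_⟩
  · rintro p ⟨k, i', j', rfl⟩ hpd
    rcases window_cases isHaggSeq_sDown hpd with ⟨rfl, rfl, rfl⟩ | ⟨hk, hL, hij⟩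
    · exact ⟨i, by simp⟩
    · rcases hk with rfl | rfl
      · rw [haggLabel_sDown_two] at hL
        omega
      · rw [haggLabel_sDown_neg_two] at hL
        obtain rfl : j' = 0 := by omega
        obtain rfl : i' = 0 := by omega
        refine ⟨j₀, ?_⟩
        rw [hq, barlowPos_zero_zero_zero, sub_zero, barlowPos_sDown_neg_two]
        simp
  · intro j hj
    rcases hiso j (by linarith) with hji | hjj
    · exact ⟨_, barlowPos_mem 0 0 0, by rw [hji]; simp⟩
    · refine ⟨_, barlowPos_mem (-2) 0 0, ?_⟩
      rw [hjj, hq, barlowPos_zero_zero_zero, sub_zero, barlowPos_sDown_neg_two]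
      simp

/-- **An isolated particle is a Barlow window** (and equally an hcp window): with `a = h = 199/100`
the `6/5`-window of a site is the site alone. [folklore] -/
theorem barlowMatched_of_isolated {N : ℕ} (X : Fin N → E3) (i : Fin N)
    (hiso : ∀ j : Fin N, dist (X j) (X i) < 10 → X j = X i) :
    BarlowMatched (6 / 5) (1 / 100) X i := by
  refine ⟨199 / 100, 199 / 100, by norm_num, by norm_num, by norm_num, by norm_num, constHagg,
    isHaggSeq_const, barlowPos (199 / 100) (199 / 100) constHagg 0 0 0, barlowPos_mem _ _ _,
    LinearIsometry.id, ?_, ?_⟩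
  · intro p hp hpd
    refine ⟨i, ?_⟩
    have : p = barlowPos (199 / 100) (199 / 100) constHagg 0 0 0 := by
      by_contra hne
      have := le_dist_of_mem_barlowStacking (199 / 100) (199 / 100) constHagg (by norm_num)
        (by norm_num) hp (barlowPos_mem 0 0 0) hne
      rw [min_self] at this
      linarith
    rw [this]
    simp
  · intro j hj
    refine ⟨_, barlowPos_mem 0 0 0, ?_⟩
    rw [hiso j (by linarith)]
    simp

end Summit.AtomisticToContinuum.Crystallization.Theorems.StackingFaultSparsityNegative

end
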